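import Mathlib
import HarnessLib
import Literature.Analysis.FluidPDE.TypeIAncientMild
import Summits.NavierStokesRegularity.NavierStokesRegularity.Theorems.PoloidalWindowDoorPoloidalWindowRigidityHotHullCompactness
import Summits.NavierStokesRegularity.NavierStokesRegularity.Theorems.PoloidalWindowDoorPoloidalWindowRigidityLeastPinAnisotropicGap

/-!
# Route `PoloidalWindowDoor`, crux `PoloidalWindowRigidity` (stmt-NavierStokesRegularity-19708) — LINE 24 «least_pin» v1.0
# (ns-idea-8 g11, `Cruxes/PoloidalWindowRigidity/Lines/least_pin.lean` 98e095f0b5f9): support stub U3b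
# `stub_noPinLoss : AnisotropicGap → ∀ C v, Pinned C v → Peakless v → LeastPin C v → NoPinLoss C v`, VERBATIM (the Cruxes-local
# `AnisotropicGap` / `Pinned` / `Peakless` / `LeastPin` / `NoPinLoss` unfolded)

Seat ns-es-p1 g8 (free prover hand on ⟨19708⟩; CLAIM announced on the ideators bus before proposing).

* `peakless_nsRescale` — the S-lemma of the card: `Peakless` (unfolded) is invariant under the parabolic rescaling `nsRescale c`, `c > 0`
  (island brackets at time `s` on the plane `{y₂ = z₀}` map to island brackets at time `c²s` on `{y₂ = c z₀}` with level `M/c`, under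
  the homothety `q ↦ c q`, a homeomorphism).
* `noPinLoss` — **NO PIN LOSS for least-pin profiles.**  If `v` is a least-pin profile of the pinned–peakless class 𝒫(C) and `V ∈ A_C` is
  e₂-poloidal, peakless, dominated by the pin (`√(−t)|V₂| ≤ |N|`, `N = v₂(−1,0)`) and `V ≢ 0`, then `sup √(−t)|V₂| = |N|`.

PROOF (template: the tree's `…PoloidalExtremal.exists_poloidal_extremal`, p469616, and `…HotHullCompactness.classCompactness` / the line's
`pinnedCompact`).  If `sup √(−t)|V₂| ≤ |N| − η`, let `m := sup_{t<0,x} √(−t)|V₂(t,x)|` (`≤ |N| − η`); `m > 0` because `V₂(−1,·) ≢ 0` by vertical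
rigidity (`…LeastPinAnisotropicGap.eq_zero_of_coordTwo_eq_zero`).  Near-sup points `(tₖ, xₖ)` (`√(−tₖ)|V₂(tₖ,xₖ)| > m − 1/(k+1)`) and the
renormalised fields `wₖ := nsRescale √(−tₖ) (V(·, xₖ + ·))`: class `C` (`isTypeIAncientMild_nsRescale ∘ isTypeIAncientMild_translate`),
poloidal (`poloidal_nsRescale ∘ poloidal_translate`), PEAKLESS (`peakless_nsRescale ∘ peakless_translate`), dominated `√(−s)|wₖ,₂| ≤ m` (scale
invariance) with `|wₖ,₂(−1,0)| > m − 1/(k+1)`.  A KNSS limit with gradients, slice-wise locally uniform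
(`Theorems.exists_tendsto_of_isTypeIAncientMild_seq`), `W ∈ A_C` is poloidal (`poloidal_of_tendsto`), peakless (`peaklessClosed`), dominated by
`m = |W₂(−1,0)| ≠ 0`; the three pins follow by Fermat (`threadPin_of_hotSpot`, `threadSignedPin`), so `W ∈ 𝒫(C)` with pin value `m`, and
the least-pin property of `v` gives `|N| ≤ m ≤ |N| − η` — absurd.  (The hypothesis U3a is not needed for this direction and is carried
verbatim.)

HONEST LABEL: ONE support stub (M) of a files-only line (critic verdict pending at typing time; fired only after PASS); it closes no cell, no crux
and no route item; the research cell `CellLeastPin`, ⟨19708⟩ / ⟨20428⟩ and NS regularity stay OPEN — no summit statement is proved here.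
-/

noncomputable section

-- the summit and its single sub-problem share the name (CONVENTIONS §1), as in every Theorems file
set_option linter.dupNamespace false

namespace Summit.NavierStokesRegularity.NavierStokesRegularity.Theorems.PoloidalWindowDoorPoloidalWindowRigidityLeastPinNoPinLoss

open Set Function Filter Topology
open scoped RealInnerProductSpace InnerProductSpace Laplacian
open Literature.Analysis Literature.Analysis.FluidPDE
open Summit.NavierStokesRegularity.NavierStokesRegularity.Theorems
open Summit.NavierStokesRegularity.NavierStokesRegularity.Theorems.PoloidalWindowDoorPoloidalWindowRigidityPoloidalExtremal
open Summit.NavierStokesRegularity.NavierStokesRegularity.Theorems.PoloidalWindowDoorPoloidalWindowRigidityHotHullCompactness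
open Summit.NavierStokesRegularity.NavierStokesRegularity.Theorems.PoloidalWindowDoorPoloidalWindowRigidityLeastPinAnisotropicGap

/-! ## `Peakless` is invariant under parabolic rescaling -/

/-- **S-lemma.**  `Peakless` (unfolded) is invariant under the parabolic rescaling `nsRescale c`, `c > 0`. -/
theorem peakless_nsRescale {u : ℝ → EuclideanSpace ℝ (Fin 3) → EuclideanSpace ℝ (Fin 3)}
    (hK : ∀ (s z₀ σ M : ℝ) (K O : Set (EuclideanSpace ℝ (Fin 3))), s < 0 →
      ((σ = 1 ∨ σ = -1) ∧ IsCompact K ∧ K.Nonempty ∧ (∀ y ∈ K, y 2 = z₀ ∧ σ * u s y 2 = M) ∧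
      IsOpen O ∧ K ⊆ O ∧ (∀ y ∈ O, y 2 = z₀ → σ * u s y 2 ≤ M) ∧
      (∀ y ∈ O, y 2 = z₀ → σ * u s y 2 = M → y ∈ K)) → False)
    {c : ℝ} (hc : 0 < c) :
    ∀ (s z₀ σ M : ℝ) (K O : Set (EuclideanSpace ℝ (Fin 3))), s < 0 →
      ((σ = 1 ∨ σ = -1) ∧ IsCompact K ∧ K.Nonempty ∧ (∀ y ∈ K, y 2 = z₀ ∧ σ * (nsRescale c u) s y 2 = M) ∧
      IsOpen O ∧ K ⊆ O ∧ (∀ y ∈ O, y 2 = z₀ → σ * (nsRescale c u) s y 2 ≤ M) ∧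
      (∀ y ∈ O, y 2 = z₀ → σ * (nsRescale c u) s y 2 = M → y ∈ K)) → False := by
  intro s z₀ σ M K O hs h
  obtain ⟨hσ, hKc, hKne, hKval, hO, hKO, hOle, hOeq⟩ := h
  have hw : ∀ q : EuclideanSpace ℝ (Fin 3), nsRescale c u s q 2 = c * u (c ^ 2 * s) (c • q) 2 := fun q => by
    rw [nsRescale_apply, PiLp.smul_apply, smul_eq_mul]
  have hc2 : ∀ q : EuclideanSpace ℝ (Fin 3), (c • q) 2 = c * q 2 := fun q => by
    rw [PiLp.smul_apply, smul_eq_mul]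
  have hφ : Continuous fun q : EuclideanSpace ℝ (Fin 3) => c • q := continuous_const_smul c
  have hOi : IsOpen ((fun q : EuclideanSpace ℝ (Fin 3) => c • q) '' O) :=
    (Homeomorph.smulOfNeZero c hc.ne').isOpenMap O hO
  have hs' : c ^ 2 * s < 0 := mul_neg_of_pos_of_neg (pow_pos hc 2) hs
  refine hK (c ^ 2 * s) (c * z₀) σ (M / c) ((fun q => c • q) '' K) ((fun q => c • q) '' O) hs'
    ⟨hσ, hKc.image hφ, hKne.image _, ?_, hOi, Set.image_mono hKO, ?_, ?_⟩
  · rintro _ ⟨q, hq, rfl⟩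
    refine ⟨by rw [hc2, (hKval q hq).1], ?_⟩
    have h1 := (hKval q hq).2
    rw [hw] at h1
    rw [eq_div_iff hc.ne']
    linear_combination h1
  · rintro _ ⟨q, hq, rfl⟩ hq2
    have hq2' : q 2 = z₀ := mul_left_cancel₀ hc.ne' (by rw [← hc2]; exact hq2)
    have h1 := hOle q hq hq2'
    rw [hw] at h1
    rw [le_div_iff₀ hc]
    linarith
  · rintro _ ⟨q, hq, rfl⟩ hq2 hval
    have hq2' : q 2 = z₀ := mul_left_cancel₀ hc.ne' (by rw [← hc2]; exact hq2)
    have hval' : σ * nsRescale c u s q 2 = M := by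
      rw [hw]
      rw [eq_div_iff hc.ne'] at hval
      linear_combination hval
    exact ⟨q, hOeq q hq hq2' hval', rfl⟩

/-! ## The stub -/

/-- **U3b (VERBATIM, the Cruxes-local defs unfolded): no pin loss for least-pin profiles** (module docstring for the proof). -/
theorem noPinLoss :
    (∀ C : ℝ, ∃ δ : ℝ, 0 < δ ∧ ∀ v : ℝ → EuclideanSpace ℝ (Fin 3) → EuclideanSpace ℝ (Fin 3), IsTypeIAncientMild C v →
      (∀ s < 0, ∀ y, ⟪curl (v s) y, EuclideanSpace.single 2 1⟫_ℝ = 0) →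
      (∀ t < 0, ∀ x, Real.sqrt (-t) * |v t x 2| ≤ δ) → ∀ t < 0, ∀ x, v t x = 0) →
    ∀ (C : ℝ) (v : ℝ → EuclideanSpace ℝ (Fin 3) → EuclideanSpace ℝ (Fin 3)),
      (Literature.Analysis.FluidPDE.HasTypeITimeDecay C v ∧
        ContinuousOn (Function.uncurry v) (Set.Iio (0 : ℝ) ×ˢ Set.univ) ∧
        (∀ s t : ℝ, s < t → t < 0 → ∀ x, v t x =
        Literature.Analysis.UnboundedOperators.heatExtension (v s) (t - s) x -
        Literature.Analysis.FluidPDE.oseenDuhamel 1 s v v t x) ∧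
        (∀ t < 0, Literature.Analysis.FluidPDE.VectorCalculus.IsDivFree (v t)) ∧
        (∀ s < 0, ∀ y, ⟪Literature.Analysis.FluidPDE.curl (v s) y, EuclideanSpace.single 2 1⟫_ℝ = 0) ∧
        v (-1) 0 2 ≠ 0 ∧ (∀ t < 0, ∀ x, Real.sqrt (-t) * |v t x 2| ≤ |v (-1) 0 2|) ∧
        (∀ h : EuclideanSpace ℝ (Fin 3), fderiv ℝ (v (-1)) 0 h 2 = 0) ∧
        (deriv (fun s => v s 0 2) (-1) = v (-1) 0 2 / 2 ∧ v (-1) 0 2 * (Δ (fun y => v (-1) y 2)) 0 ≤ 0)) →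
      (∀ (s z₀ σ M : ℝ) (K O : Set (EuclideanSpace ℝ (Fin 3))), s < 0 →
        ((σ = 1 ∨ σ = -1) ∧ IsCompact K ∧ K.Nonempty ∧ (∀ y ∈ K, y 2 = z₀ ∧ σ * v s y 2 = M) ∧
        IsOpen O ∧ K ⊆ O ∧ (∀ y ∈ O, y 2 = z₀ → σ * v s y 2 ≤ M) ∧
        (∀ y ∈ O, y 2 = z₀ → σ * v s y 2 = M → y ∈ K)) → False) →
      (∀ v' : ℝ → EuclideanSpace ℝ (Fin 3) → EuclideanSpace ℝ (Fin 3),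
        (Literature.Analysis.FluidPDE.HasTypeITimeDecay C v' ∧
          ContinuousOn (Function.uncurry v') (Set.Iio (0 : ℝ) ×ˢ Set.univ) ∧
          (∀ s t : ℝ, s < t → t < 0 → ∀ x, v' t x =
          Literature.Analysis.UnboundedOperators.heatExtension (v' s) (t - s) x -
          Literature.Analysis.FluidPDE.oseenDuhamel 1 s v' v' t x) ∧
          (∀ t < 0, Literature.Analysis.FluidPDE.VectorCalculus.IsDivFree (v' t)) ∧
          (∀ s < 0, ∀ y, ⟪Literature.Analysis.FluidPDE.curl (v' s) y, EuclideanSpace.single 2 1⟫_ℝ = 0) ∧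
          v' (-1) 0 2 ≠ 0 ∧ (∀ t < 0, ∀ x, Real.sqrt (-t) * |v' t x 2| ≤ |v' (-1) 0 2|) ∧
          (∀ h : EuclideanSpace ℝ (Fin 3), fderiv ℝ (v' (-1)) 0 h 2 = 0) ∧
          (deriv (fun s => v' s 0 2) (-1) = v' (-1) 0 2 / 2 ∧ v' (-1) 0 2 * (Δ (fun y => v' (-1) y 2)) 0 ≤ 0)) →
        (∀ (s z₀ σ M : ℝ) (K O : Set (EuclideanSpace ℝ (Fin 3))), s < 0 →
          ((σ = 1 ∨ σ = -1) ∧ IsCompact K ∧ K.Nonempty ∧ (∀ y ∈ K, y 2 = z₀ ∧ σ * v' s y 2 = M) ∧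
          IsOpen O ∧ K ⊆ O ∧ (∀ y ∈ O, y 2 = z₀ → σ * v' s y 2 ≤ M) ∧
          (∀ y ∈ O, y 2 = z₀ → σ * v' s y 2 = M → y ∈ K)) → False) → |v (-1) 0 2| ≤ |v' (-1) 0 2|) →
      ∀ V : ℝ → EuclideanSpace ℝ (Fin 3) → EuclideanSpace ℝ (Fin 3), IsTypeIAncientMild C V →
      (∀ s < 0, ∀ y, ⟪curl (V s) y, EuclideanSpace.single 2 1⟫_ℝ = 0) → (∀ (s z₀ σ M : ℝ) (K O : Set (EuclideanSpace ℝ (Fin 3))), s < 0 →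
      ((σ = 1 ∨ σ = -1) ∧ IsCompact K ∧ K.Nonempty ∧ (∀ y ∈ K, y 2 = z₀ ∧ σ * V s y 2 = M) ∧
      IsOpen O ∧ K ⊆ O ∧ (∀ y ∈ O, y 2 = z₀ → σ * V s y 2 ≤ M) ∧
      (∀ y ∈ O, y 2 = z₀ → σ * V s y 2 = M → y ∈ K)) → False) →
      (∀ t < 0, ∀ x, Real.sqrt (-t) * |V t x 2| ≤ |v (-1) 0 2|) → (¬ ∀ t < 0, ∀ x, V t x = 0) →
      ∀ η > 0, ∃ t < 0, ∃ x, |v (-1) 0 2| - η < Real.sqrt (-t) * |V t x 2| := by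
  intro _ C v _ _ hL V hV hVpol hVK hVdom hVne η hη
  by_contra hcon
  push Not at hcon
  -- (1) the scale-covariant vertical size of `V` and its supremum `m ≤ |N| - η`
  set S : Set ℝ := {r | ∃ t : ℝ, t < 0 ∧ ∃ x : EuclideanSpace ℝ (Fin 3), r = Real.sqrt (-t) * |V t x 2|} with hS
  have hSb : BddAbove S := ⟨|v (-1) 0 2| - η, by rintro r ⟨t, ht, x, rfl⟩; exact hcon t ht x⟩
  have hSn : S.Nonempty := ⟨_, -1, by norm_num, 0, rfl⟩
  set m : ℝ := sSup S with hm
  have hle_m : ∀ t < 0, ∀ x, Real.sqrt (-t) * |V t x 2| ≤ m := fun t ht x => le_csSup hSb ⟨t, ht, x, rfl⟩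
  have hm_le : m ≤ |v (-1) 0 2| - η := csSup_le hSn (by rintro r ⟨t, ht, x, rfl⟩; exact hcon t ht x)
  -- (2) `m > 0`: otherwise `V₂(−1,·) ≡ 0` and vertical rigidity kills `V`
  have hneg1 : (-1 : ℝ) < 0 := by norm_num
  have hm0 : 0 < m := by
    by_contra hm0
    push Not at hm0
    have h2 : ∀ y, V (-1) y 2 = 0 := fun y => by
      have h := hle_m (-1) hneg1 y
      rw [neg_neg, Real.sqrt_one, one_mul] at h
      exact abs_nonpos_iff.1 (h.trans hm0)
    exact hVne (eq_zero_of_coordTwo_eq_zero hV hneg1 (hVpol (-1) hneg1) h2)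
  -- (3) near-sup points
  have hpts : ∀ k : ℕ, ∃ t < 0, ∃ x : EuclideanSpace ℝ (Fin 3), m - 1 / ((k : ℝ) + 1) < Real.sqrt (-t) * |V t x 2| := by
    intro k
    have hk : (0 : ℝ) < 1 / ((k : ℝ) + 1) := by positivity
    obtain ⟨r, ⟨t, ht, x, rfl⟩, hr⟩ := exists_lt_of_lt_csSup hSn (show m - 1 / ((k : ℝ) + 1) < m by linarith)
    exact ⟨t, ht, x, hr⟩
  choose tk htk xk hxk using hpts
  -- (4) renormalisation to `(−1, 0)`
  set wk : ℕ → ℝ → EuclideanSpace ℝ (Fin 3) → EuclideanSpace ℝ (Fin 3) := fun k =>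
    nsRescale (Real.sqrt (-tk k)) (fun t x => V t (xk k + x)) with hwk_def
  have hck : ∀ k, 0 < Real.sqrt (-tk k) := fun k => Real.sqrt_pos.2 (neg_pos.2 (htk k))
  have hwk : ∀ k, IsTypeIAncientMild C (wk k) := fun k =>
    isTypeIAncientMild_nsRescale (isTypeIAncientMild_translate hV (xk k)) (hck k)
  have hwkpol : ∀ k, ∀ s < 0, ∀ y, ⟪curl (wk k s) y, EuclideanSpace.single 2 (1 : ℝ)⟫_ℝ = 0 := fun k =>
    poloidal_nsRescale (poloidal_translate hVpol (xk k)) (hck k)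
  have hwkK : ∀ k, 
      ∀ (s z₀ σ M : ℝ) (K O : Set (EuclideanSpace ℝ (Fin 3))), s < 0 →
      ((σ = 1 ∨ σ = -1) ∧ IsCompact K ∧ K.Nonempty ∧ (∀ y ∈ K, y 2 = z₀ ∧ σ * (wk k) s y 2 = M) ∧
      IsOpen O ∧ K ⊆ O ∧ (∀ y ∈ O, y 2 = z₀ → σ * (wk k) s y 2 ≤ M) ∧
      (∀ y ∈ O, y 2 = z₀ → σ * (wk k) s y 2 = M → y ∈ K)) → False := by
    intro k
    have e : (fun t x => V t (x + xk k)) = fun t x => V t (xk k + x) := by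
      funext t x; rw [add_comm]
    have h1 := peakless_translate hVK (xk k)
    rw [e] at h1
    exact peakless_nsRescale h1 (hck k)
  have hw_apply : ∀ k s y, wk k s y =
      Real.sqrt (-tk k) • V (Real.sqrt (-tk k) ^ 2 * s) (xk k + Real.sqrt (-tk k) • y) := fun k s y => by
    simp [hwk_def, nsRescale_apply]
  have hw2 : ∀ k s y, wk k s y 2 =
      Real.sqrt (-tk k) * V (Real.sqrt (-tk k) ^ 2 * s) (xk k + Real.sqrt (-tk k) • y) 2 := fun k s y => by
    rw [hw_apply, PiLp.smul_apply, smul_eq_mul]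
  -- the hot value: `m − 1/(k+1) < |wₖ,₂(−1,0)| `
  have hlow : ∀ k : ℕ, m - 1 / ((k : ℝ) + 1) < |wk k (-1) 0 2| := fun k => by
    rw [hw2, smul_zero, add_zero, mul_neg_one, Real.sq_sqrt (neg_nonneg.2 (htk k).le), neg_neg, abs_mul,
      abs_of_pos (hck k)]
    exact hxk k
  -- domination is scale-invariant
  have hwdom : ∀ k, ∀ s < 0, ∀ y, Real.sqrt (-s) * |wk k s y 2| ≤ m := by
    intro k s hs y
    set c : ℝ := Real.sqrt (-tk k) with hc
    have hc0 : 0 < c := hck k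
    have hs' : c ^ 2 * s < 0 := mul_neg_of_pos_of_neg (pow_pos hc0 2) hs
    have h := hle_m (c ^ 2 * s) hs' (xk k + c • y)
    have hsq : Real.sqrt (-(c ^ 2 * s)) = c * Real.sqrt (-s) := by
      rw [show -(c ^ 2 * s) = c ^ 2 * (-s) by ring, Real.sqrt_mul' _ (neg_nonneg.2 hs.le), Real.sqrt_sq hc0.le]
    rw [hsq] at h
    rw [hw2, ← hc, abs_mul, abs_of_pos hc0]
    calc Real.sqrt (-s) * (c * |V (c ^ 2 * s) (xk k + c • y) 2|)
        = c * Real.sqrt (-s) * |V (c ^ 2 * s) (xk k + c • y) 2| := by ring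
      _ ≤ m := h
  -- (5) KNSS compactness with gradients, slice-wise locally uniform
  obtain ⟨φ, hφ, W, hW, hpt, hfd, htlu, -⟩ := exists_tendsto_of_isTypeIAncientMild_seq C hwk
  have hrate : HasTypeITimeDecay C W := hW.hasTypeITimeDecay
  have hcont : ContinuousOn (Function.uncurry W) (Set.Iio (0 : ℝ) ×ˢ Set.univ) := hW.1.continuousOn
  have hmild : ∀ s t : ℝ, s < t → t < 0 → ∀ x, W t x =
      UnboundedOperators.heatExtension (W s) (t - s) x - oseenDuhamel 1 s W W t x :=
    fun s t hst ht x => hW.mild_eq_heatExtension hst ht x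
  have hdiv : ∀ t < 0, VectorCalculus.IsDivFree (W t) := fun t ht => hW.isDivFree ht
  have hWpol : ∀ s < 0, ∀ y, ⟪curl (W s) y, EuclideanSpace.single 2 1⟫_ℝ = 0 := fun s hs y =>
    poloidal_of_tendsto (hfd s hs y) (fun j => hwkpol (φ j) s hs y)
  have hc2 : Continuous fun x : EuclideanSpace ℝ (Fin 3) => x 2 := by fun_prop
  have hval : ∀ t < 0, ∀ x, Tendsto (fun j => wk (φ j) t x 2) atTop (𝓝 (W t x 2)) :=
    fun t ht x => (hc2.tendsto _).comp (hpt t ht x)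
  -- the pin value of the limit is `m`
  have hNabs : Tendsto (fun j => |wk (φ j) (-1) 0 2|) atTop (𝓝 |W (-1) 0 2|) :=
    (continuous_abs.tendsto _).comp (hval (-1) hneg1 0)
  have hup : ∀ j, |wk (φ j) (-1) 0 2| ≤ m := fun j => by
    have h := hwdom (φ j) (-1) hneg1 0
    rwa [neg_neg, Real.sqrt_one, one_mul] at h
  have hlim1 : Tendsto (fun j : ℕ => m - 1 / ((j : ℝ) + 1)) atTop (𝓝 m) := by
    have h0 : Tendsto (fun j : ℕ => 1 / ((j : ℝ) + 1)) atTop (𝓝 0) := tendsto_one_div_add_atTop_nhds_zero_nat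
    simpa using (tendsto_const_nhds (x := m)).sub h0
  have hlow' : ∀ j : ℕ, m - 1 / ((j : ℝ) + 1) ≤ |wk (φ j) (-1) 0 2| := fun j => by
    refine le_trans ?_ (hlow (φ j)).le
    have hj : (j : ℝ) ≤ ((φ j : ℕ) : ℝ) := by exact_mod_cast hφ.id_le j
    gcongr
  have hNm : |W (-1) 0 2| = m :=
    le_antisymm (le_of_tendsto' hNabs hup) (le_of_tendsto_of_tendsto' hlim1 hNabs hlow')
  have hne : W (-1) 0 2 ≠ 0 := by
    intro h0
    rw [h0, abs_zero] at hNm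
    linarith
  -- the Type-I extremality of the vertical component passes to the limit
  have hhot : ∀ t < 0, ∀ x, Real.sqrt (-t) * |W t x 2| ≤ |W (-1) 0 2| := by
    intro t ht x
    have hlim : Tendsto (fun j => Real.sqrt (-t) * |wk (φ j) t x 2|) atTop (𝓝 (Real.sqrt (-t) * |W t x 2|)) :=
      ((continuous_const.mul continuous_abs).tendsto _).comp (hval t ht x)
    rw [hNm]
    exact le_of_tendsto' hlim fun j => hwdom (φ j) t ht x
  -- the pins by Fermat at the hot spot of the limit
  have hPW : 
      Literature.Analysis.FluidPDE.HasTypeITimeDecay C W ∧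
      ContinuousOn (Function.uncurry W) (Set.Iio (0 : ℝ) ×ˢ Set.univ) ∧
      (∀ s t : ℝ, s < t → t < 0 → ∀ x, W t x =
      Literature.Analysis.UnboundedOperators.heatExtension (W s) (t - s) x -
      Literature.Analysis.FluidPDE.oseenDuhamel 1 s W W t x) ∧
      (∀ t < 0, Literature.Analysis.FluidPDE.VectorCalculus.IsDivFree (W t)) ∧
      (∀ s < 0, ∀ y, ⟪Literature.Analysis.FluidPDE.curl (W s) y, EuclideanSpace.single 2 1⟫_ℝ = 0) ∧
      W (-1) 0 2 ≠ 0 ∧ (∀ t < 0, ∀ x, Real.sqrt (-t) * |W t x 2| ≤ |W (-1) 0 2|) ∧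
      (∀ h : EuclideanSpace ℝ (Fin 3), fderiv ℝ (W (-1)) 0 h 2 = 0) ∧
      (deriv (fun s => W s 0 2) (-1) = W (-1) 0 2 / 2 ∧ W (-1) 0 2 * (Δ (fun y => W (-1) y 2)) 0 ≤ 0) :=
    ⟨hrate, hcont, hmild, hdiv, hWpol, hne, hhot,
      PoloidalWindowDoorLrcModEntireThreadPins.threadPin_of_hotSpot hrate hcont hmild hhot,
      PoloidalWindowDoorLrcModEntireThreadPins.threadSignedPin C W hrate hcont hmild hdiv hne hhot⟩
  -- `Peakless` passes to the limit
  have hKW : 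
      ∀ (s z₀ σ M : ℝ) (K O : Set (EuclideanSpace ℝ (Fin 3))), s < 0 →
      ((σ = 1 ∨ σ = -1) ∧ IsCompact K ∧ K.Nonempty ∧ (∀ y ∈ K, y 2 = z₀ ∧ σ * W s y 2 = M) ∧
      IsOpen O ∧ K ⊆ O ∧ (∀ y ∈ O, y 2 = z₀ → σ * W s y 2 ≤ M) ∧
      (∀ y ∈ O, y 2 = z₀ → σ * W s y 2 = M → y ∈ K)) → False :=
    peaklessClosed (fun j => wk (φ j)) W (fun j => hwkK (φ j)) (fun j t ht => (hwk (φ j)).continuous_slice ht)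
      (fun t ht => hW.continuous_slice ht) (fun t ht => htlu t ht)
  -- (6) least pin: `|N| ≤ |W₂(−1,0)| = m ≤ |N| − η`
  have h := hL W hPW hKW
  rw [hNm] at h
  linarith

end Summit.NavierStokesRegularity.NavierStokesRegularity.Theorems.PoloidalWindowDoorPoloidalWindowRigidityLeastPinNoPinLoss

end
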